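import Mathlib
import Literature.Computability.AlgebraicComplexity.GroupTheoreticMatMul
import Literature.Computability.AlgebraicComplexity.GroupTheoreticMatMulThmBProofs
import Summits.MatrixMultiplication.MatrixMultiplication.Theses.ThinBlockAlpha
import Summits.MatrixMultiplication.MatrixMultiplication.Theorems.ThinBlockAlphaThinPackingsOrbitCriterion
import Summits.MatrixMultiplication.MatrixMultiplication.Theorems.ThinBlockAlphaThinPackingsOrbitStubProduct
import Summits.MatrixMultiplication.MatrixMultiplication.Theorems.ThinBlockAlphaThinPackingsOrbitStubPacking
import Summits.MatrixMultiplication.MatrixMultiplication.Theorems.ThinBlockAlphaThinPackingsOrbitStubMatrixCriterion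
import Summits.MatrixMultiplication.MatrixMultiplication.Theorems.ThinBlockAlphaThinPackingsOrbitStubCharCount
import Summits.MatrixMultiplication.MatrixMultiplication.Theorems.ThinBlockAlphaThinPackingsOrbitStubCharParseval
import Summits.MatrixMultiplication.MatrixMultiplication.Theorems.ThinBlockAlphaThinPackingsOrbitStubLargeCoeff
import Summits.MatrixMultiplication.MatrixMultiplication.Theorems.ThinBlockAlphaThinPackingsOrbitStubInvariantCoeff
import Summits.MatrixMultiplication.MatrixMultiplication.Theorems.ThinBlockAlphaThinPackingsOrbitStubSolCount
import Summits.MatrixMultiplication.MatrixMultiplication.Theorems.ThinBlockAlphaThinPackingsOrbitStubLegCard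
import Summits.MatrixMultiplication.MatrixMultiplication.Theorems.ThinBlockAlphaThinPackingsOrbitGainCap
import Summits.MatrixMultiplication.MatrixMultiplication.Theorems.ThinBlockAlphaThinPackingsOrbitCapCorollaries

set_option linter.dupNamespace false

/-!
# Line `Ideator4Sketch` (card `automorphism-orbit-twisted-templates`) — skeleton v5 for crux
`ThinBlockAlpha.ThinPackings` (stmt-MatrixMultiplication-10595, route ThinBlockAlpha)

Lead a3 (prover-line-stmt-MatrixMultiplication-10595-a3-0), 2026-08-16; reshaped from the ideator's
`Cruxes/ThinPackings/Ideator4Sketch.lean` (crux-ideate r2 k4).  v5 (lead c4, 2026-08-16T20:30Z):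
adds stub S `stub_orbitSymmetrisation` = the CONVERSE of the transfer (`ThinPackings →` orbit
designs, by Perm-symmetrisation of a tensor power of the crux witness: template
`(∏ A_i, ∏ B_i, ∏ C_i)` in `H^ι` under `(Perm ι)ᵈᵐᵃ`, slack loss `|ι|^|ι|/|ι|! ≤ e^|ι|` absorbed
by `N^{|ι|η/2}` once `N^{η/2} ≥ e`; kernel-checked in the lead's `work/OrbitEquiv.lean`, landing as
`Theorems/ThinBlockAlphaThinPackingsOrbitSymmetrisation.lean`).  CONSEQUENCE: the heart
`stub_orbitDesigns ↔ ThinPackings ↔ CThesis` (p76748) — the orbit restriction is void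
asymptotically; the line is the crux in costume, not a reduction of it.

THE LINE.  Index the blocks of an STPP family by a finite group `Γ` of additive automorphisms of the
host `H`: `(A_γ, B_γ, C_γ) = (γ • A, γ • B, γ • C)` for ONE template.  ORBIT CRITERION (LANDED,
`Theorems/ThinBlockAlphaThinPackingsOrbitCriterion.lean`, p122325): the orbit family is `IsSTPP` iff the
template is TPP (`TemplateTPP`) and Γ-TWISTED TRICOLOURED SUM-FREE (`TwistedSumFree`).  So the crux follows
from ORBIT DESIGNS (stub 2 = the heart, `Stmt.stub_orbitDesigns`).

v1 stubs (cycle 1): 1 `stub_orbitTransfer` LANDED p122325; 3 `stub_orbitProduct` LANDED p122723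
(products of orbit designs are orbit designs — one design per `(a,η)` suffices, gains multiply);
4 `stub_orbitPacking` LANDED p122728 (difference sets are partial transversals of FREE orbits,
`|Γ|·N² ≤ |H|`); 5 `stub_matrixCriterion` LANDED p122776 (the card's K3 for `GL_n`).
v2 added the FOURIER-CAP programme (stubs F1–F7; F1–F6 LANDED p123124 p123199 p123206 p123229 p123223
p123227, F7 LANDED p123568) and its corollaries F8 (free actions: no gain) and F9 (the heart needs
stabilisers `≥ N^{3a−2−4η}/4`), LANDED p123694.  v4/v5: every tool stub is landed; the ONLY sorry is the heart (≡ the crux, v5).  THE CAP: for ANY orbit design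
whose nontrivial characters have Γ-stabilisers of size `≤ S`,
        `|Γ|⁴ · (|A||B||C|)² ≤ 4·S·|H|³`,   i.e.   gain² ≤ 4·S·|H| / |Γ|²
(proof: the solution count of `x+y+z=0` on the Γ-saturated difference sets is EXACTLY `|Γ|·|A||B||C|`
— far below the random count — so some nontrivial Fourier coefficient is large (Cauchy–Schwarz), and
Γ-invariance copies it over a whole Γ-orbit of characters, which Parseval pays for).  Consequences
(lead's analysis, NOTES/line card): free actions on `Ĥ ∖ 0` (tori, Singer cycles) have NO gain; for
`GL_n(q)` on `n×(2n+1)` matrices the large coefficient sits at a RANK-ONE character and the card's K1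
corner `M ≈ q^{n²/2}` (a = n/(n+1)) is impossible — the refined cap is `a ≤ (3n−1)/(3n+3) + O(η)`, which
still tends to 1: the line survives, trimmed.

Composition `ThinPackings_of : Stmt.stub_orbitDesigns → ThinPackings` = the landed transfer.
Disproof.lean (cdisprove cycles 1–3, 06:13Z) read: no `_false_without_`; §4 Targets = dead frame stub only.
-/

namespace Summit.MatrixMultiplication.MatrixMultiplication.Cruxes.ThinPackings.OrbitTemplates

open Finset Literature.Computability.AlgebraicComplexity
open scoped Pointwise
open Summit.MatrixMultiplication.MatrixMultiplication.Theses.ThinBlockAlpha (ThinPackings)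
open Summit.MatrixMultiplication.MatrixMultiplication.Theorems.ThinPackings.Orbit

/-! ## Statement of the heart as a named `Prop` -/
namespace Stmt

/-- `stub_orbitDesigns` (the heart = the card's `OrbitThinPackings`): thin near-tight orbit designs
exist for every shape exponent. -/
def stub_orbitDesigns : Prop :=
  ∀ a : ℝ, 0 ≤ a → a < 1 → ∀ η : ℝ, 0 < η →
    ∃ (Γ H : Type) (_ : Group Γ) (_ : Fintype Γ) (_ : AddCommGroup H) (_ : Fintype H)
      (_ : DecidableEq H) (_ : DistribMulAction Γ H) (N M : ℕ) (A B C : Finset H),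
      TemplateTPP A B C ∧ TwistedSumFree Γ A B C ∧
      A.card = N ∧ B.card = M ∧ C.card = N ∧ 2 ≤ N ∧ (N : ℝ) ^ a ≤ M ∧
      (Fintype.card H : ℝ) ≤ Fintype.card Γ * (N : ℝ) ^ (2 + η)

end Stmt

/-! ## Stub 1 (TRANSFER) — LANDED p122325 (`Orbit.stub_orbitTransfer` / `thinPackings_of_orbitDesigns`). -/
theorem stub_orbitTransfer :
    (∀ a : ℝ, 0 ≤ a → a < 1 → ∀ η : ℝ, 0 < η →
      ∃ (Γ H : Type) (_ : Group Γ) (_ : Fintype Γ) (_ : AddCommGroup H) (_ : Fintype H)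
        (_ : DecidableEq H) (_ : DistribMulAction Γ H) (N M : ℕ) (A B C : Finset H),
        TemplateTPP A B C ∧ TwistedSumFree Γ A B C ∧
        A.card = N ∧ B.card = M ∧ C.card = N ∧ 2 ≤ N ∧ (N : ℝ) ^ a ≤ M ∧
        (Fintype.card H : ℝ) ≤ Fintype.card Γ * (N : ℝ) ^ (2 + η)) → ThinPackings :=
  Summit.MatrixMultiplication.MatrixMultiplication.Theorems.ThinPackings.Orbit.stub_orbitTransfer

/-! ## Stub 2 (HEART, open — the lead's): `OrbitThinPackings`.  Strictly stronger than the crux;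
by stub 3 one design per `(a, η)` suffices.  Necessary (v2, Fourier cap): the nontrivial characters of
`H` must have Γ-stabilisers of size `≥ |Γ|²·gain²/(4|H|) ≥ N^{3a−2−4η}/4` — for `a > 2/3` the group
must fix characters massively (rank-one phenomenon for `GL_n`). -/
theorem stub_orbitDesigns :
    ∀ a : ℝ, 0 ≤ a → a < 1 → ∀ η : ℝ, 0 < η →
      ∃ (Γ H : Type) (_ : Group Γ) (_ : Fintype Γ) (_ : AddCommGroup H) (_ : Fintype H)
        (_ : DecidableEq H) (_ : DistribMulAction Γ H) (N M : ℕ) (A B C : Finset H),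
        TemplateTPP A B C ∧ TwistedSumFree Γ A B C ∧
        A.card = N ∧ B.card = M ∧ C.card = N ∧ 2 ≤ N ∧ (N : ℝ) ^ a ≤ M ∧
        (Fintype.card H : ℝ) ≤ Fintype.card Γ * (N : ℝ) ^ (2 + η) := by
  sorry

/-! ## Stub S support, INLINED (lead c4): the symmetrisation lemmas of the landed
`Theorems/ThinBlockAlphaThinPackingsOrbitSymmetrisation.lean` (p124473), copied verbatim under this
namespace so that the skeleton elaborates before the farm has built that module; switch stub S to
`Summit.MatrixMultiplication.MatrixMultiplication.Theorems.ThinPackings.Orbit.stub_orbitSymmetrisation`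
and delete this section once it is built. -/
namespace SymmetrisationInline

open Literature.Combinatorics.Additive (AddSimultaneousTPP addSimultaneousTPP_iff_forall)

section Symmetrise

variable {ι H : Type} [Fintype ι] [DecidableEq ι] [AddCommGroup H] {A B C : ι → Finset H}

/-- The box template `(∏ A_i, ∏ B_i, ∏ C_i)` of an STPP family is TPP (coordinatewise, the
diagonal clause `i = j = k` of the family). [new, elementary] -/
theorem templateTPP_piFinset (h : AddSimultaneousTPP A B C) :
    TemplateTPP (Fintype.piFinset A) (Fintype.piFinset B) (Fintype.piFinset C) := by
  rw [addSimultaneousTPP_iff_forall] at h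
  intro a ha a' ha' b hb b' hb' c hc c' hc' h0
  simp only [Fintype.mem_piFinset] at ha ha' hb hb' hc hc'
  have hl : ∀ l, a l = a' l ∧ b l = b' l ∧ c l = c' l := fun l => by
    have h0l := congr_fun h0 l
    simp only [Pi.add_apply, Pi.sub_apply, Pi.zero_apply] at h0l
    obtain ⟨-, -, h1, h2, h3⟩ :=
      h l l l _ (ha l) _ (ha' l) _ (hb l) _ (hb' l) _ (hc l) _ (hc' l) h0l
    exact ⟨h1, h2, h3⟩
  exact ⟨funext fun l => (hl l).1, funext fun l => (hl l).2.1, funext fun l => (hl l).2.2⟩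

/-- The box template of an STPP family is twisted sum-free under the coordinate permutations
`(Perm ι)ᵈᵐᵃ` (acting by `(g • x) l = x (σ l)`, `σ = mk.symm g`): a twisted relation read in
coordinate `l` is an STPP relation of the family with labels `(σ l, τ l, l)`, whence
`σ l = τ l = l`. [new, elementary] -/
theorem twistedSumFree_piFinset (h : AddSimultaneousTPP A B C) :
    TwistedSumFree (Equiv.Perm ι)ᵈᵐᵃ
      (Fintype.piFinset A) (Fintype.piFinset B) (Fintype.piFinset C) := by
  rw [addSimultaneousTPP_iff_forall] at h
  intro g k hgk a' ha' b hb b' hb' c hc c' hc' a ha h0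
  simp only [Fintype.mem_piFinset] at ha ha' hb hb' hc hc'
  apply hgk
  set σ := DomMulAct.mk.symm g with hσ
  set τ := DomMulAct.mk.symm k with hτ
  have hl : ∀ l, σ l = l ∧ τ l = l := fun l => by
    have h0l := congr_fun h0 l
    simp only [Pi.add_apply, Pi.sub_apply, Pi.zero_apply, DomMulAct.smul_apply,
      Equiv.Perm.smul_def] at h0l
    rw [← hσ, ← hτ] at h0l
    obtain ⟨h1, h2, -⟩ := h (σ l) (τ l) l (a l) (ha l) (a' (σ l)) (ha' _) (b (σ l)) (hb _)
      (b' (τ l)) (hb' _) (c (τ l)) (hc _) (c' l) (hc' l) (by rw [← h0l]; abel)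
    exact ⟨h1.trans h2, h2⟩
  have hσ1 : σ = 1 := Equiv.ext fun l => by rw [Equiv.Perm.one_apply]; exact (hl l).1
  have hτ1 : τ = 1 := Equiv.ext fun l => by rw [Equiv.Perm.one_apply]; exact (hl l).2
  have hg : g = 1 := by
    rw [← DomMulAct.mk.apply_symm_apply g, ← hσ, hσ1]; rfl
  have hk : k = 1 := by
    rw [← DomMulAct.mk.apply_symm_apply k, ← hτ, hτ1]; rfl
  rw [hg, hk]

end Symmetrise

/-- Cardinality of a box all of whose sides have `N` elements. -/
theorem card_piFinset_of_card_eq {ι α : Type} [Fintype ι] [DecidableEq ι] {A : ι → Finset α}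
    {N : ℕ} (hA : ∀ i, (A i).card = N) :
    (Fintype.piFinset A).card = N ^ Fintype.card ι := by
  rw [Fintype.card_piFinset, Finset.prod_congr rfl fun i _ => hA i, Finset.prod_const,
    Finset.card_univ]

/-- `n^n ≤ n!·e^n` (the term `n^n/n!` of the exponential series). -/
theorem pow_self_le_factorial_mul_exp (n : ℕ) :
    (n : ℝ) ^ n ≤ (n.factorial : ℝ) * Real.exp 1 ^ n := by
  have h := Real.pow_div_factorial_le_exp (n : ℝ) (Nat.cast_nonneg n) n
  rw [div_le_iff₀ (by positivity)] at h
  calc (n : ℝ) ^ n ≤ Real.exp n * n.factorial := h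
    _ = n.factorial * Real.exp 1 ^ n := by rw [← Real.exp_nat_mul, mul_one, mul_comm]

/-- The slack bookkeeping of the symmetrised power: if `|H| ≤ L·N^{2+η/2}` and `e ≤ (N^{η/2})^k`
then `|H|^{k·n} ≤ n!·(N^{k n})^{2+η}` for `n = L^k`. -/
theorem symmetrised_slack {L k n N : ℕ} {η Hc : ℝ} (hn : n = L ^ k) (hHc : 0 ≤ Hc)
    (hN : 0 < (N : ℝ)) (hH : Hc ≤ L * (N : ℝ) ^ (2 + η / 2))
    (he : Real.exp 1 ≤ ((N : ℝ) ^ (η / 2)) ^ k) :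
    Hc ^ (k * n) ≤ (n.factorial : ℝ) * ((N : ℝ) ^ (k * n)) ^ (2 + η) := by
  -- abbreviations
  set P : ℝ := (N : ℝ) ^ (2 + η / 2) with hP
  set x : ℝ := ((N : ℝ) ^ (η / 2)) ^ k with hx
  have hP0 : 0 < P := Real.rpow_pos_of_pos hN _
  have hx0 : 0 ≤ x := pow_nonneg (Real.rpow_nonneg hN.le _) _
  -- the right-hand side, rewritten: `(N^{kn})^{2+η} = P^{kn} · x^n`
  have hR : ((N : ℝ) ^ (k * n)) ^ (2 + η) = P ^ (k * n) * x ^ n := by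
    have h1 : ((N : ℝ) ^ (k * n)) ^ (2 + η) = ((N : ℝ) ^ (2 + η)) ^ (k * n) := by
      rw [← Real.rpow_natCast_mul hN.le, mul_comm ((k * n : ℕ) : ℝ) (2 + η),
        Real.rpow_mul_natCast hN.le]
    have h2 : (N : ℝ) ^ (2 + η) = P * (N : ℝ) ^ (η / 2) := by
      rw [hP, ← Real.rpow_add hN]; congr 1; ring
    rw [h1, h2, mul_pow, pow_mul ((N : ℝ) ^ (η / 2)) k n]
  -- the left-hand side: `Hc^{kn} ≤ (L P)^{kn} = n^n · P^{kn}`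
  have hL : Hc ^ (k * n) ≤ (n : ℝ) ^ n * P ^ (k * n) := by
    calc Hc ^ (k * n) ≤ ((L : ℝ) * P) ^ (k * n) := pow_le_pow_left₀ hHc hH _
      _ = (n : ℝ) ^ n * P ^ (k * n) := by
          rw [mul_pow, pow_mul, hn]; push_cast; ring
  -- `n^n ≤ n! e^n ≤ n! x^n`
  have hmid : (n : ℝ) ^ n ≤ (n.factorial : ℝ) * x ^ n :=
    (pow_self_le_factorial_mul_exp n).trans
      (mul_le_mul_of_nonneg_left (pow_le_pow_left₀ (Real.exp_pos 1).le he n)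
        (Nat.cast_nonneg _))
  calc Hc ^ (k * n) ≤ (n : ℝ) ^ n * P ^ (k * n) := hL
    _ ≤ (n.factorial : ℝ) * x ^ n * P ^ (k * n) :=
        mul_le_mul_of_nonneg_right hmid (pow_nonneg hP0.le _)
    _ = (n.factorial : ℝ) * ((N : ℝ) ^ (k * n)) ^ (2 + η) := by rw [hR]; ring

/-- **The crux gives orbit designs** (converse of the transfer `thinPackings_of_orbitDesigns`):
every thin near-tight STPP family symmetrises into a thin near-tight orbit design — the box
template of its `k`-th tensor power under the coordinate permutations of `H^{(Fin k → Fin L)}`.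
Hence the line's heart `stub_orbitDesigns` is the crux in costume. [new, elementary] -/
theorem orbitDesigns_of_thinPackings (hT : ThinPackings) :
    ∀ a : ℝ, 0 ≤ a → a < 1 → ∀ η : ℝ, 0 < η →
      ∃ (Γ H : Type) (_ : Group Γ) (_ : Fintype Γ) (_ : AddCommGroup H) (_ : Fintype H)
        (_ : DecidableEq H) (_ : DistribMulAction Γ H) (N M : ℕ) (A B C : Finset H),
        TemplateTPP A B C ∧ TwistedSumFree Γ A B C ∧
        A.card = N ∧ B.card = M ∧ C.card = N ∧ 2 ≤ N ∧ (N : ℝ) ^ a ≤ M ∧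
        (Fintype.card H : ℝ) ≤ Fintype.card Γ * (N : ℝ) ^ (2 + η) := by
  intro a ha0 ha1 η hη
  obtain ⟨H, _, _, L, N, M, A, B, C, hS, hc, hN, hM, hH⟩ := hT a ha0 ha1 (η / 2) (by positivity)
  classical
  -- numerics of the witness
  have hN1 : (1 : ℝ) < N := by exact_mod_cast (by omega : 1 < N)
  have hN0 : (0 : ℝ) < N := by linarith
  have hL : 1 ≤ L := by
    rcases Nat.eq_zero_or_pos L with rfl | hLpos
    · exfalso
      have h0 : (0 : ℝ) < Fintype.card H := by exact_mod_cast Fintype.card_pos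
      rw [Nat.cast_zero, zero_mul] at hH
      linarith
    · exact hLpos
  -- the power `k` with `e ≤ (N^{η/2})^k`
  have hy : (1 : ℝ) < (N : ℝ) ^ (η / 2) := Real.one_lt_rpow hN1 (by positivity)
  obtain ⟨k, hk⟩ := pow_unbounded_of_one_lt (Real.exp 1) hy
  have hk1 : 1 ≤ k := by
    rcases Nat.eq_zero_or_pos k with rfl | hk0
    · rw [pow_zero] at hk
      exact absurd hk (not_lt.2 (Real.one_lt_exp_iff.2 one_pos).le)
    · exact hk0
  -- step 1: the `k`-th tensor power (index `Fin k → Fin L`, host `Fin k → H`)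
  set ι := Fin k → Fin L
  have hS₁ := ((isSTPP_iff_addSimultaneousTPP A B C).1 hS).pi (κ := Fin k)
  set A₁ : ι → Finset (Fin k → H) := fun I => Fintype.piFinset fun l => A (I l) with hA₁
  set B₁ : ι → Finset (Fin k → H) := fun I => Fintype.piFinset fun l => B (I l) with hB₁
  set C₁ : ι → Finset (Fin k → H) := fun I => Fintype.piFinset fun l => C (I l) with hC₁
  change AddSimultaneousTPP A₁ B₁ C₁ at hS₁
  have hcA₁ : ∀ I, (A₁ I).card = N ^ k := fun I => by
    simp only [hA₁, Fintype.card_piFinset, (hc _).1, prod_const, card_univ, Fintype.card_fin]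
  have hcB₁ : ∀ I, (B₁ I).card = M ^ k := fun I => by
    simp only [hB₁, Fintype.card_piFinset, (hc _).2.1, prod_const, card_univ, Fintype.card_fin]
  have hcC₁ : ∀ I, (C₁ I).card = N ^ k := fun I => by
    simp only [hC₁, Fintype.card_piFinset, (hc _).2.2, prod_const, card_univ, Fintype.card_fin]
  -- step 2: symmetrise over `ι`
  set n := Fintype.card ι with hn
  have hnL : n = L ^ k := by rw [hn, Fintype.card_fun, Fintype.card_fin, Fintype.card_fin]
  have hn1 : 1 ≤ n := by rw [hnL]; exact Nat.one_le_pow _ _ hL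
  letI : Fintype (Equiv.Perm ι)ᵈᵐᵃ := Fintype.ofEquiv (Equiv.Perm ι) DomMulAct.mk
  have hΓ : Fintype.card (Equiv.Perm ι)ᵈᵐᵃ = n.factorial := by
    rw [Fintype.ofEquiv_card, Fintype.card_perm]
  refine ⟨(Equiv.Perm ι)ᵈᵐᵃ, ι → (Fin k → H), inferInstance, inferInstance, inferInstance,
    inferInstance, inferInstance, inferInstance, N ^ (k * n), M ^ (k * n),
    Fintype.piFinset A₁, Fintype.piFinset B₁, Fintype.piFinset C₁,
    templateTPP_piFinset hS₁, twistedSumFree_piFinset hS₁, ?_, ?_, ?_, ?_, ?_, ?_⟩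
  · rw [card_piFinset_of_card_eq hcA₁, ← pow_mul]
  · rw [card_piFinset_of_card_eq hcB₁, ← pow_mul]
  · rw [card_piFinset_of_card_eq hcC₁, ← pow_mul]
  · calc 2 ≤ N := hN
      _ = N ^ 1 := (pow_one N).symm
      _ ≤ N ^ (k * n) := Nat.pow_le_pow_right (by omega) (Nat.one_le_iff_ne_zero.2
          (Nat.mul_ne_zero (by omega) (by omega)))
  · -- `(N^{kn})^a = (N^a)^{kn} ≤ M^{kn}`
    push_cast
    rw [← Real.rpow_natCast ((N : ℝ)), ← Real.rpow_mul hN0.le, mul_comm,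
      Real.rpow_mul_natCast hN0.le]
    exact pow_le_pow_left₀ (Real.rpow_nonneg hN0.le _) hM _
  · -- thinness: `|H|^{kn} ≤ n! (N^{kn})^{2+η}`
    rw [hΓ, Fintype.card_fun, Fintype.card_fun, Fintype.card_fin, ← hn, ← pow_mul]
    push_cast
    exact symmetrised_slack hnL (Nat.cast_nonneg _) hN0 hH hk.le

end SymmetrisationInline

/-! ## Stub S (SYMMETRISATION, lead c4) — the converse of the transfer: the crux gives orbit
designs (box template of a tensor power of the witness under the coordinate permutations
`(Perm ι)ᵈᵐᵃ` of `H^ι`), so the heart is EQUIVALENT to the crux (`heart_iff_crux` below).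
LANDED p124473 (`Theorems/ThinBlockAlphaThinPackingsOrbitSymmetrisation.lean`,
`Orbit.stub_orbitSymmetrisation` / `Orbit.orbitDesigns_iff_thinPackings`). -/
theorem stub_orbitSymmetrisation : Summit.MatrixMultiplication.MatrixMultiplication.Theses.ThinBlockAlpha.ThinPackings → (∀ a : ℝ, 0 ≤ a → a < 1 → ∀ η : ℝ, 0 < η → ∃ (Γ H : Type) (_ : Group Γ) (_ : Fintype Γ) (_ : AddCommGroup H) (_ : Fintype H) (_ : DecidableEq H) (_ : DistribMulAction Γ H) (N M : ℕ) (A B C : Finset H), TemplateTPP A B C ∧ TwistedSumFree Γ A B C ∧ A.card = N ∧ B.card = M ∧ C.card = N ∧ 2 ≤ N ∧ (N : ℝ) ^ a ≤ M ∧ (Fintype.card H : ℝ) ≤ Fintype.card Γ * (N : ℝ) ^ (2 + η)) :=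
  fun h => SymmetrisationInline.orbitDesigns_of_thinPackings h

/-- The heart is the crux in costume (kernel-checked: transfer p122325 + symmetrisation p124473). -/
theorem heart_iff_crux : Stmt.stub_orbitDesigns ↔ ThinPackings :=
  ⟨fun h => stub_orbitTransfer h, fun h => stub_orbitSymmetrisation h⟩

/-! ## Stub 3 (products) — LANDED p122723. -/
theorem stub_orbitProduct :
    ∀ {Γ₁ H₁ Γ₂ H₂ : Type} [Group Γ₁] [Fintype Γ₁] [AddCommGroup H₁] [Fintype H₁] [DecidableEq H₁]
      [DistribMulAction Γ₁ H₁] [Group Γ₂] [Fintype Γ₂] [AddCommGroup H₂] [Fintype H₂] [DecidableEq H₂]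
      [DistribMulAction Γ₂ H₂] (A₁ B₁ C₁ : Finset H₁) (A₂ B₂ C₂ : Finset H₂),
      TemplateTPP A₁ B₁ C₁ → TwistedSumFree Γ₁ A₁ B₁ C₁ →
      TemplateTPP A₂ B₂ C₂ → TwistedSumFree Γ₂ A₂ B₂ C₂ →
      ∃ (_ : DistribMulAction (Γ₁ × Γ₂) (H₁ × H₂)),
        TemplateTPP (A₁ ×ˢ A₂) (B₁ ×ˢ B₂) (C₁ ×ˢ C₂) ∧
        TwistedSumFree (Γ₁ × Γ₂) (A₁ ×ˢ A₂) (B₁ ×ˢ B₂) (C₁ ×ˢ C₂) :=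
  Summit.MatrixMultiplication.MatrixMultiplication.Theorems.ThinPackings.Orbit.stub_orbitProduct

/-! ## Stub 4 (packing necessities) — LANDED p122728. -/
theorem stub_orbitPacking :
    ∀ {Γ H : Type} [Group Γ] [Fintype Γ] [AddCommGroup H] [Fintype H] [DecidableEq H]
      [DistribMulAction Γ H] (A B C : Finset H), A.Nonempty → B.Nonempty → C.Nonempty →
      TemplateTPP A B C → TwistedSumFree Γ A B C →
      (∀ g : Γ, g ≠ 1 → Disjoint ((A - C).image fun x => g • x) (A - C)) ∧
      (∀ g : Γ, g ≠ 1 → Disjoint ((A - B).image fun x => g • x) (A - B)) ∧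
      (∀ g : Γ, g ≠ 1 → Disjoint ((B - C).image fun x => g • x) (B - C)) ∧
      Fintype.card Γ * (A.card * C.card) ≤ Fintype.card H ∧
      Fintype.card Γ * (A.card * B.card) ≤ Fintype.card H ∧
      Fintype.card Γ * (B.card * C.card) ≤ Fintype.card H :=
  Summit.MatrixMultiplication.MatrixMultiplication.Theorems.ThinPackings.Orbit.stub_orbitPacking

/-! ## Stub 5 (the card's K3 matrix criterion) — LANDED p122776. -/
theorem stub_matrixCriterion :
    ∀ (F : Type) [Field F] [DecidableEq F] (n r : ℕ) (A B C : Finset (Matrix (Fin n) (Fin r) F)),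
      (∀ x ∈ A - B, ∀ y ∈ B - C, ∀ z ∈ C - A,
        (∃ g h : Matrix (Fin n) (Fin n) F, g * x + h * y + z = 0) → x + y + z = 0) →
      (∀ x ∈ A - B, ∀ y ∈ B - C, x + y ∈ A - C →
        ∀ g h : Matrix (Fin n) (Fin n) F, g * x + h * y = 0 → g = 0 ∧ h = 0) →
      TemplateTPP A B C →
      MatrixTwistedSumFree F n r A B C :=
  Summit.MatrixMultiplication.MatrixMultiplication.Theorems.ThinPackings.Orbit.stub_matrixCriterion

/-! ## v2: the FOURIER-CAP programme (stubs F1–F7, all provable now; F7 = the lead's assembly)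

Notation: for a finset `S` and a character `ψ : AddChar H ℂ`, the coefficient `Ŝ(ψ) = ∑_{x ∈ S} ψ x`.
The Γ-saturated difference sets of a template are written as images
`X = {g • (a − b)}`, `Y = {g • (b − c)}`, `Z = {g • (c − a)}` over `univ ×ˢ (A ×ˢ B)` etc. -/

/-- F1 (counting identity): `∑_ψ X̂(ψ) Ŷ(ψ) Ẑ(ψ) = |H| · #{(x,y,z) ∈ X×Y×Z : x+y+z = 0}`
(orthogonality `AddChar.sum_apply_eq_ite` after `ψ x ψ y ψ z = ψ (x+y+z)`). -/
theorem stub_charCount : ∀ {H : Type} [AddCommGroup H] [Fintype H] [DecidableEq H] (X Y Z : Finset H), ∑ ψ : AddChar H ℂ, (∑ x ∈ X, ψ x) * (∑ y ∈ Y, ψ y) * (∑ z ∈ Z, ψ z) = (Fintype.card H : ℂ) * ((((X ×ˢ Y) ×ˢ Z).filter fun t => t.1.1 + t.1.2 + t.2 = 0).card : ℂ) :=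
  Summit.MatrixMultiplication.MatrixMultiplication.Theorems.ThinPackings.Orbit.stub_charCount

/-- F2 (Parseval): `∑_ψ ‖X̂(ψ)‖² = |H|·|X|` (`‖s‖² = s·conj s`, `conj (ψ x) = ψ (−x)`, orthogonality). -/
theorem stub_charParseval : ∀ {H : Type} [AddCommGroup H] [Fintype H] [DecidableEq H] (X : Finset H), ∑ ψ : AddChar H ℂ, ‖∑ x ∈ X, ψ x‖ ^ 2 = (Fintype.card H : ℝ) * X.card :=
  Summit.MatrixMultiplication.MatrixMultiplication.Theorems.ThinPackings.Orbit.stub_charParseval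

/-- F3 (abstract Cauchy–Schwarz extraction): if `∑ u v w = K` then some index `i ≠ i₀` has
`‖u i₀ v i₀ w i₀‖ − |K| ≤ ‖u i‖ · √(Pv·Pw)` whenever `∑‖v‖² ≤ Pv`, `∑‖w‖² ≤ Pw`. -/
theorem stub_largeCoeff : ∀ {ι : Type} [Fintype ι] [DecidableEq ι] (i₀ i₁ : ι) (u v w : ι → ℂ) (K Pv Pw : ℝ), i₁ ≠ i₀ → (∑ i, u i * v i * w i : ℂ) = K → 0 ≤ Pv → 0 ≤ Pw → ∑ i, ‖v i‖ ^ 2 ≤ Pv → ∑ i, ‖w i‖ ^ 2 ≤ Pw → ∃ i, i ≠ i₀ ∧ (‖u i₀ * v i₀ * w i₀‖ - |K|) ≤ ‖u i‖ * Real.sqrt (Pv * Pw) :=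
  Summit.MatrixMultiplication.MatrixMultiplication.Theorems.ThinPackings.Orbit.stub_largeCoeff

/-- F4 (invariance spreads a coefficient over an orbit of characters): if `X` is Γ-invariant, every
set of elements stabilising `ψ` has size `≤ S`, and `∑_χ ‖X̂(χ)‖² ≤ P`, then `|Γ|·‖X̂(ψ)‖² ≤ S·P`
(the characters `ψ ∘ g` are `≥ |Γ|/S` many and all have the coefficient of `ψ`). -/
theorem stub_invariantCoeff : ∀ {Γ H : Type} [Group Γ] [Fintype Γ] [AddCommGroup H] [Fintype H] [DecidableEq H] [DistribMulAction Γ H] (X : Finset H), (∀ g : Γ, ∀ x ∈ X, g • x ∈ X) → ∀ (ψ : AddChar H ℂ) (S : ℕ) (P : ℝ), 0 < S → (∀ T : Finset Γ, (∀ g ∈ T, ψ.compAddMonoidHom (DistribSMul.toAddMonoidHom H g) = ψ) → T.card ≤ S) → ∑ χ : AddChar H ℂ, ‖∑ x ∈ X, χ x‖ ^ 2 ≤ P → (Fintype.card Γ : ℝ) * ‖∑ x ∈ X, ψ x‖ ^ 2 ≤ S * P :=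
  Summit.MatrixMultiplication.MatrixMultiplication.Theorems.ThinPackings.Orbit.stub_invariantCoeff

/-- F5 (solution count of an orbit design): on the Γ-saturated difference sets every solution of
`x + y + z = 0` is a Γ-translate of a trivial one, so there are at most `|Γ|·|A||B||C|` of them
(divide by the `Z`-label, `TwistedSumFree`, then `TemplateTPP`). -/
theorem stub_solCount : ∀ {Γ H : Type} [Group Γ] [Fintype Γ] [AddCommGroup H] [Fintype H] [DecidableEq H] [DistribMulAction Γ H] (A B C : Finset H), TemplateTPP A B C → TwistedSumFree Γ A B C → (((((univ : Finset Γ) ×ˢ (A ×ˢ B)).image fun p => p.1 • (p.2.1 - p.2.2)) ×ˢ (((univ : Finset Γ) ×ˢ (B ×ˢ C)).image fun p => p.1 • (p.2.1 - p.2.2))) ×ˢ (((univ : Finset Γ) ×ˢ (C ×ˢ A)).image fun p => p.1 • (p.2.1 - p.2.2)) |>.filter fun t => t.1.1 + t.1.2 + t.2 = 0).card ≤ Fintype.card Γ * (A.card * B.card * C.card) :=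
  Summit.MatrixMultiplication.MatrixMultiplication.Theorems.ThinPackings.Orbit.stub_solCount

/-- F6 (sizes of the saturated difference sets): `|X| = |Γ||A||B|`, `|Y| = |Γ||B||C|`,
`|Z| = |Γ||C||A|` (injectivity of `(g, s, t) ↦ g • (s − t)`, as inside the landed
`Orbit.card_mul_card_mul_card_le`; also Γ-invariance of the three images). -/
theorem stub_orbitLegCard : ∀ {Γ H : Type} [Group Γ] [Fintype Γ] [AddCommGroup H] [Fintype H] [DecidableEq H] [DistribMulAction Γ H] (A B C : Finset H), A.Nonempty → B.Nonempty → C.Nonempty → TemplateTPP A B C → TwistedSumFree Γ A B C → (((univ : Finset Γ) ×ˢ (A ×ˢ B)).image fun p => p.1 • (p.2.1 - p.2.2)).card = Fintype.card Γ * (A.card * B.card) ∧ (((univ : Finset Γ) ×ˢ (B ×ˢ C)).image fun p => p.1 • (p.2.1 - p.2.2)).card = Fintype.card Γ * (B.card * C.card) ∧ (((univ : Finset Γ) ×ˢ (C ×ˢ A)).image fun p => p.1 • (p.2.1 - p.2.2)).card = Fintype.card Γ * (C.card * A.card) ∧ (∀ (S T : Finset H) (g : Γ), ∀ x ∈ ((univ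 : Finset Γ) ×ˢ (S ×ˢ T)).image (fun p => p.1 • (p.2.1 - p.2.2)), g • x ∈ ((univ : Finset Γ) ×ˢ (S ×ˢ T)).image (fun p => p.1 • (p.2.1 - p.2.2))) :=
  Summit.MatrixMultiplication.MatrixMultiplication.Theorems.ThinPackings.Orbit.stub_orbitLegCard

/-- F7 (THE FOURIER CAP, lead's assembly of F1–F6): an orbit design all of whose nontrivial
characters have Γ-stabilisers of size `≤ S`, and which is not absurdly small (`2|H| ≤ |Γ|²·|A||B||C|`),
satisfies `|Γ|⁴·(|A||B||C|)² ≤ 4·S·|H|³` — gain² ≤ 4 S |H| / |Γ|². -/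
theorem stub_orbitGainCap : ∀ {Γ H : Type} [Group Γ] [Fintype Γ] [AddCommGroup H] [Fintype H] [DecidableEq H] [DistribMulAction Γ H] (A B C : Finset H) (S : ℕ), TemplateTPP A B C → TwistedSumFree Γ A B C → 0 < S → (∀ ψ : AddChar H ℂ, ψ ≠ 0 → ∀ T : Finset Γ, (∀ g ∈ T, ψ.compAddMonoidHom (DistribSMul.toAddMonoidHom H g) = ψ) → T.card ≤ S) → 2 * Fintype.card H ≤ Fintype.card Γ ^ 2 * (A.card * B.card * C.card) → Fintype.card Γ ^ 4 * (A.card * B.card * C.card) ^ 2 ≤ 4 * S * Fintype.card H ^ 3 :=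
  Summit.MatrixMultiplication.MatrixMultiplication.Theorems.ThinPackings.Orbit.stub_orbitGainCap

/-- F8 (corollary of F7, `S = 1`): if `Γ` acts FREELY on the nontrivial characters (tori, Singer cycles,
Frobenius complements) an orbit design has NO gain: `|Γ|⁴ (|A||B||C|)² ≤ 4 |H|³`. -/
theorem stub_freeActionCap : ∀ {Γ H : Type} [Group Γ] [Fintype Γ] [AddCommGroup H] [Fintype H] [DecidableEq H] [DistribMulAction Γ H] (A B C : Finset H), TemplateTPP A B C → TwistedSumFree Γ A B C → (∀ ψ : AddChar H ℂ, ψ ≠ 0 → ∀ g : Γ, ψ.compAddMonoidHom (DistribSMul.toAddMonoidHom H g) = ψ → g = 1) → 2 * Fintype.card H ≤ Fintype.card Γ ^ 2 * (A.card * B.card * C.card) → Fintype.card Γ ^ 4 * (A.card * B.card * C.card) ^ 2 ≤ 4 * Fintype.card H ^ 3 :=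
  Summit.MatrixMultiplication.MatrixMultiplication.Theorems.ThinPackings.Orbit.stub_freeActionCap

/-- F9 (corollary of F7 in the heart's parameters): a witness of `Stmt.stub_orbitDesigns` at `(a, η)` whose
nontrivial characters have stabilisers of size `≤ S` has `N^{3a − 2 − 4η} ≤ 4 S` — for `a > 2/3` the group
must fix nontrivial characters massively (the rank-one phenomenon for `GL_n`). -/
theorem stub_heartNeedsStabilisers : ∀ {Γ H : Type} [Group Γ] [Fintype Γ] [AddCommGroup H] [Fintype H] [DecidableEq H] [DistribMulAction Γ H] (A B C : Finset H) (S N M : ℕ) (a η : ℝ), TemplateTPP A B C → TwistedSumFree Γ A B C → 0 < S → (∀ ψ : AddChar H ℂ, ψ ≠ 0 → ∀ T : Finset Γ, (∀ g ∈ T, ψ.compAddMonoidHom (DistribSMul.toAddMonoidHom H g) = ψ) → T.card ≤ S) → A.card = N → B.card = M → C.card = N → 2 ≤ N → 0 ≤ a → (N : ℝ) ^ a ≤ M → 0 ≤ η → (Fintype.card H : ℝ) ≤ Fintype.card Γ * (N : ℝ) ^ (2 + η) → 2 * Fintype.card H ≤ Fintype.card Γ ^ 2 * (A.card * B.card * C.card)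 → (N : ℝ) ^ (3 * a - 2 - 4 * η) ≤ 4 * S :=
  Summit.MatrixMultiplication.MatrixMultiplication.Theorems.ThinPackings.Orbit.stub_heartNeedsStabilisers

/-! ## Composition (kernel-checked modulo the heart): orbit designs ⟹ the crux, by name -/

/-- **Orbit designs ⟹ `ThinPackings`.** -/
theorem ThinPackings_of : Stmt.stub_orbitDesigns → ThinPackings := fun h => stub_orbitTransfer h

/-- The skeleton closes the crux modulo the registered stubs. -/
theorem ThinPackings_proof : ThinPackings := ThinPackings_of stub_orbitDesigns

end Summit.MatrixMultiplication.MatrixMultiplication.Cruxes.ThinPackings.OrbitTemplates
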